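import Mathlib.Analysis.SpecialFunctions.Pow.Real
import Mathlib.Analysis.SpecialFunctions.Sqrt

/-!
# EriceRemainderEnclosureHistoryAutonomyComparisonSlackSystemSharp — (E64f) THE SLACK SYSTEM WITH AVERAGED COUPLINGS CLOSES AT RATIO `14`: as (E64b), with
# own-window couplings `g_i ≥ 9∕20` (youngest: `≥ 1∕4`) and defects `ε_{i,i′} ≤ (8∕7)·14^{−(i−i′)}` (youngest: `≤ 2·14^{−(i−i′)}`) ⟹ every read but the youngest
# is `≤ (7∕10)·slack`, the youngest `≤ 0.87·slack`, and **`Σ_{i<n} ρ_i ≤ η`** for EVERY height — the abstract half of (E64g) `…ComparisonTowerSlackFourteen`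

Cell `pub-balaban`, β-function sub-cell, BINDER row D4 «RemainderConst leaves for Bałaban's split» (`HOME/BINDER-OWNERS.md`; owner lineage `b2b-balaban-beta-an4`;
this file by co-owner #2 lineage `b2b-balaban-beta-d4-p2`, generation 57), β-FLOW TEAM duty (1), FREEZE (0) honoured (def-free; imports Mathlib only).

HONEST FRAMING (page 1, verbatim and binding).  *"Discharging BetaPertH makes Bałaban's UV stability UNCONDITIONAL — a real constructive-QFT result; it is
NOT the continuum limit and NOT the Clay problem."*  THIS FILE DISCHARGES NOTHING OF THE KIND.  A finite system of linear inequalities between real numbers and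
its elementary consequence — no functional, no flow, nothing of Bałaban's; the system is the one (E64g) derives along the comparison configuration of the
cell's own NOT-IN-PRINT comparison conjecture (E58′).  Row D4 class UNCHANGED (critical-path width 0; instance 0∕1; D4 DISCHARGE NO DATE).  HONEST
DEPENDENCY: continuum YM on T⁴ ⇐ BetaPertH ∧ nine spine estimates (0/9 proved); BetaPertH ⇐ (D1) ∧ (D4) ∧ CAP+tail; G-an2-4 gates asym, D1 and NE2/3/4.

THE POINT (census sense (α); the COMPARISON column, conjecture (E58′)).  (E64b) closed the tower system with the WORST coupling of every window (`(k′∕(k′+j))²`: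
own window `1∕4`, defect `2j∕k′`) at ratio `30`.  Keeping the drops read at the scales `1 … j` separately, the coupling is the AVERAGE
`(1∕j)Σ_{l≤j}(k′∕(k′+l))² ≥ k′²∕((k′+1)(k′+j+1))` (telescoping): own window `→ 1∕2` (`≥ 9∕20` from age `14` on), defect `≤ (j+2)∕k′`.  With these the same
induction — every older read at most `κ = 7∕10` of ITS slack, slacks losing at most `10∕3` per age, defects summing to `(8∕7)(7∕10)Σ_m(10∕42)^m = 1∕4` of
the slack, `(5∕4)·x∕(1 + 9x∕20) ≤ 7∕10` for `x ≤ √2∕2` — closes at ratio **`14`** (§2 `read_le_slack`); the YOUNGEST age (which may be `1`, own window only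
`1∕4`, defect `2j∕k′`) is the last step and needs only `read ≤ slack`: `(x∕(1+x∕4))·(1 + 2·(7∕10)(5∕16)) ≤ 0.87` (§2 `sum_le_of_slack_system`).  The limit of
the scheme without joint load budgets is `R ≈ 12.5`; with the budgets of `HOME/…/g57/e64/README.md` (`x_i + 0.27x_{i+1} + … ≤ √2∕2`) it would be `≈ 7`.

WHAT IS PROVED ([folklore]; 0 `def`, 0 sorry).  §1 `geom_sum_le`, `le_pow_mul_of_le_mul`.  §2 **`read_le_slack`**, **`sum_le_of_slack_system`**.
-/
noncomputable section
open Finset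

namespace Summit.QuantumFields.BalabanUV.Beta.EriceRemainderEnclosureHistoryAutonomyComparisonSlackSystemSharp

/-! ## §1 Bookkeeping -/

/-- The geometric tail `Σ_{i′<i} (5∕21)^{i−i′} ≤ 5∕16`. [folklore] -/
theorem geom_sum_le (i : ℕ) : ∑ i' ∈ range i, (5 / 21 : ℝ) ^ (i - i') ≤ 5 / 16 := by
  induction i with
  | zero => norm_num
  | succ i ih =>
    rw [sum_range_succ, show i + 1 - i = 1 by omega, pow_one]
    have e : ∑ i' ∈ range i, (5 / 21 : ℝ) ^ (i + 1 - i') = 5 / 21 * ∑ i' ∈ range i, (5 / 21 : ℝ) ^ (i - i') := by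
      rw [mul_sum]
      exact sum_congr rfl fun i' hi' => by
        rw [show i + 1 - i' = (i - i') + 1 by have := mem_range.mp hi'; omega, pow_succ]; ring
    rw [e]; linarith

/-- CHAINING A ONE-STEP LOSS FACTOR `3∕10`: if `v_j ≤ (10∕3)·v_{j+1}` for all `j < i` then `v_{i′} ≤ (10∕3)^{i−i′}·v_i` for all `i′ ≤ i`. [folklore] -/
theorem le_pow_mul_of_le_mul {v : ℕ → ℝ} : ∀ {i : ℕ}, (∀ j < i, v j ≤ 10 / 3 * v (j + 1)) → ∀ i' ≤ i, v i' ≤ (10 / 3) ^ (i - i') * v i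
  | 0, _, i', hi' => by rw [Nat.le_zero.mp hi']; simp
  | i + 1, h4, i', hi' => by
    rcases Nat.lt_or_ge i' (i + 1) with hlt | hge
    · have ih := le_pow_mul_of_le_mul (i := i) (fun j hj => h4 j (Nat.lt_succ_of_lt hj)) i' (Nat.le_of_lt_succ hlt)
      have hst := h4 i (Nat.lt_succ_self i)
      have hpow : (0 : ℝ) ≤ (10 / 3) ^ (i - i') := by positivity
      calc v i' ≤ (10 / 3) ^ (i - i') * v i := ih
        _ ≤ (10 / 3) ^ (i - i') * (10 / 3 * v (i + 1)) := mul_le_mul_of_nonneg_left hst hpow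
        _ = (10 / 3) ^ (i + 1 - i') * v (i + 1) := by rw [show i + 1 - i' = (i - i') + 1 by omega, pow_succ]; ring
    · have : i' = i + 1 := le_antisymm hi' hge
      subst this; simp

/-! ## §2 The slack system with averaged couplings closes at ratio `14` -/

/-- **EVERY PIN READ BUT THE YOUNGEST IS AT MOST `7∕10` OF THE SLACK IT SEES.**  Ages `i < n` from the OLDEST; loads `0 ≤ x_i ≤ √2∕2`; reads `ρ_i ≥ 0`; excess
`η ≥ 0`; own-window couplings `g_i` with `g_i ≥ 9∕20` for every age but the youngest (`i + 1 < n`); defects `ε_{i,i′} ≤ (8∕7)·14^{−(i−i′)}` (`i′ < i`, `i + 1 < n`);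
THE SYSTEM `ρ_i·(1 + g_i·x_i) ≤ x_i·(η − Σ_{i′<i}(1 − ε_{i,i′})·ρ_{i′})`.  Then `ρ_j ≤ (7∕10)·v_j`, `v_j = η − Σ_{i′<j} ρ_{i′}`, for every `j + 1 < n`: older
reads `≤ (7∕10)·slack`, slacks lose at most `10∕3` per age, defects `Σ_{m≥1}(8∕7)(10∕42)^m·(7∕10) = (8∕7)(7∕10)(5∕16) = 1∕4` of the slack, and
`(5∕4)·x∕(1 + 9x∕20) ≤ 7∕10` for `x ≤ √2∕2` (needs only `x ≤ 0.748`). [folklore] -/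
theorem read_le_slack {n : ℕ} {x ρ g : ℕ → ℝ} {ε : ℕ → ℕ → ℝ} {η : ℝ} (hη : 0 ≤ η)
    (hx0 : ∀ i < n, 0 ≤ x i) (hx : ∀ i < n, x i ≤ Real.sqrt 2 / 2) (hρ : ∀ i < n, 0 ≤ ρ i)
    (hg : ∀ i, i + 1 < n → 9 / 20 ≤ g i) (hε : ∀ i, i + 1 < n → ∀ i' < i, ε i i' ≤ 8 / 7 * (1 / 14) ^ (i - i'))
    (hsys : ∀ i < n, ρ i * (1 + g i * x i) ≤ x i * (η - ∑ i' ∈ range i, (1 - ε i i') * ρ i')) :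
    ∀ i, i + 1 ≤ n → ∀ j < i, ρ j ≤ 7 / 10 * (η - ∑ i' ∈ range j, ρ i') := by
  set v : ℕ → ℝ := fun j => η - ∑ i' ∈ range j, ρ i' with hv_def
  have hv0 : v 0 = η := by simp [hv_def]
  have hvsucc : ∀ j, v (j + 1) = v j - ρ j := fun j => by simp only [hv_def, sum_range_succ]; ring
  have hs2 : Real.sqrt 2 < 1.4143 := by rw [Real.sqrt_lt' (by norm_num)]; norm_num
  have hstep : ∀ i, i + 1 < n → (∀ j < i, ρ j ≤ 7 / 10 * v j) → ρ i ≤ 7 / 10 * v i := by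
    intro i hi ih
    have hin : i < n := by omega
    have h4 : ∀ j < i, v j ≤ 10 / 3 * v (j + 1) := fun j hj => by rw [hvsucc]; linarith [ih j hj]
    have hchain := le_pow_mul_of_le_mul h4
    have hvi : 0 ≤ v i := by
      have := hchain 0 (Nat.zero_le i)
      rw [hv0, Nat.sub_zero] at this
      nlinarith [pow_pos (by norm_num : (0:ℝ) < 10 / 3) i]
    have hE : ∑ i' ∈ range i, ε i i' * ρ i' ≤ 1 / 4 * v i := by
      have hterm : ∀ i' ∈ range i, ε i i' * ρ i' ≤ 4 / 5 * v i * (5 / 21 : ℝ) ^ (i - i') := by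
        intro i' hi'
        have hi'i : i' < i := mem_range.mp hi'
        have hρi' : 0 ≤ ρ i' := hρ i' (hi'i.trans hin)
        have hc : 0 ≤ 8 / 7 * (1 / 14 : ℝ) ^ (i - i') := by positivity
        calc ε i i' * ρ i' ≤ 8 / 7 * (1 / 14 : ℝ) ^ (i - i') * ρ i' := mul_le_mul_of_nonneg_right (hε i hi i' hi'i) hρi'
          _ ≤ 8 / 7 * (1 / 14 : ℝ) ^ (i - i') * (7 / 10 * v i') := mul_le_mul_of_nonneg_left (ih i' hi'i) hc
          _ ≤ 8 / 7 * (1 / 14 : ℝ) ^ (i - i') * (7 / 10 * ((10 / 3) ^ (i - i') * v i)) :=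
              mul_le_mul_of_nonneg_left (by linarith [hchain i' hi'i.le]) hc
          _ = 4 / 5 * v i * ((1 / 14 : ℝ) ^ (i - i') * (10 / 3) ^ (i - i')) := by ring
          _ = 4 / 5 * v i * (5 / 21 : ℝ) ^ (i - i') := by rw [← mul_pow]; norm_num
      calc ∑ i' ∈ range i, ε i i' * ρ i' ≤ ∑ i' ∈ range i, 4 / 5 * v i * (5 / 21 : ℝ) ^ (i - i') := sum_le_sum hterm
        _ = 4 / 5 * v i * ∑ i' ∈ range i, (5 / 21 : ℝ) ^ (i - i') := by rw [mul_sum]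
        _ ≤ 4 / 5 * v i * (5 / 16) := mul_le_mul_of_nonneg_left (geom_sum_le i) (by positivity)
        _ = 1 / 4 * v i := by ring
    have hsi := hsys i hin
    have hsplit : η - ∑ i' ∈ range i, (1 - ε i i') * ρ i' = v i + ∑ i' ∈ range i, ε i i' * ρ i' := by
      simp only [hv_def]
      rw [sub_add, ← sum_sub_distrib]
      exact congrArg _ (sum_congr rfl fun i' _ => by ring)
    rw [hsplit] at hsi
    have hxi := hx i hin
    have hxi0 := hx0 i hin
    have hgi := hg i hi
    have h1 : ρ i * (1 + g i * x i) ≤ x i * (5 / 4 * v i) := hsi.trans (mul_le_mul_of_nonneg_left (by linarith) hxi0)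
    have h1' : ρ i * (1 + 9 / 20 * x i) ≤ ρ i * (1 + g i * x i) :=
      mul_le_mul_of_nonneg_left (by nlinarith) (hρ i hin)
    have h2 : x i * (5 / 4 * v i) ≤ 7 / 10 * v i * (1 + 9 / 20 * x i) := by
      have : x i * (5 / 4) ≤ 7 / 10 * (1 + 9 / 20 * x i) := by linarith
      nlinarith
    exact le_of_mul_le_mul_right ((h1'.trans h1).trans h2) (by linarith)
  intro i
  induction i with
  | zero => intro _ j hj; exact absurd hj (Nat.not_lt_zero j)
  | succ i ihi =>
    intro hi j hj
    have ih := ihi (by omega)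
    rcases Nat.lt_succ_iff_lt_or_eq.mp hj with hlt | heq
    · exact ih j hlt
    · rw [heq]; exact hstep i (by omega) ih

/-- **THE SLACK SYSTEM WITH AVERAGED COUPLINGS CLOSES BELOW THE EXCESS.**  As in `read_le_slack`, plus for the YOUNGEST age (`i + 1 = n`) an own-window
coupling `g_i ≥ 1∕4` and defects `ε_{i,i′} ≤ 2·14^{−(i−i′)}`.  Then `Σ_{i<n} ρ_i ≤ η` (the youngest read is at most `(x∕(1+x∕4))·(1 + 2·(7∕10)(5∕16)) ≤ 0.87`
of the last slack). [folklore] -/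
theorem sum_le_of_slack_system {n : ℕ} {x ρ g : ℕ → ℝ} {ε : ℕ → ℕ → ℝ} {η : ℝ} (hη : 0 ≤ η)
    (hx0 : ∀ i < n, 0 ≤ x i) (hx : ∀ i < n, x i ≤ Real.sqrt 2 / 2) (hρ : ∀ i < n, 0 ≤ ρ i)
    (hg : ∀ i, i + 1 < n → 9 / 20 ≤ g i) (hg' : ∀ i < n, 1 / 4 ≤ g i)
    (hε : ∀ i, i + 1 < n → ∀ i' < i, ε i i' ≤ 8 / 7 * (1 / 14) ^ (i - i'))
    (hε' : ∀ i < n, ∀ i' < i, ε i i' ≤ 2 * (1 / 14) ^ (i - i'))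
    (hsys : ∀ i < n, ρ i * (1 + g i * x i) ≤ x i * (η - ∑ i' ∈ range i, (1 - ε i i') * ρ i')) :
    ∑ i ∈ range n, ρ i ≤ η := by
  rcases Nat.eq_zero_or_pos n with rfl | hn
  · simp; exact hη
  obtain ⟨m, rfl⟩ : ∃ m, n = m + 1 := ⟨n - 1, by omega⟩
  -- the older ages: reads ≤ 7/10 of the slack
  have hmain := read_le_slack hη hx0 hx hρ hg hε hsys m le_rfl
  set v : ℕ → ℝ := fun j => η - ∑ i' ∈ range j, ρ i' with hv_def
  have hv0 : v 0 = η := by simp [hv_def]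
  have hvsucc : ∀ j, v (j + 1) = v j - ρ j := fun j => by simp only [hv_def, sum_range_succ]; ring
  have hs2 : Real.sqrt 2 < 1.4143 := by rw [Real.sqrt_lt' (by norm_num)]; norm_num
  have h4 : ∀ j < m, v j ≤ 10 / 3 * v (j + 1) := fun j hj => by
    rw [hvsucc]; have := hmain j hj; simp only [hv_def] at this ⊢; linarith
  have hchain := le_pow_mul_of_le_mul h4
  have hvm : 0 ≤ v m := by
    have := hchain 0 (Nat.zero_le m)
    rw [hv0, Nat.sub_zero] at this
    nlinarith [pow_pos (by norm_num : (0:ℝ) < 10 / 3) m]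
  -- the youngest age m: defect ≤ (7/16)·v_m, read ≤ v_m
  have hE : ∑ i' ∈ range m, ε m i' * ρ i' ≤ 7 / 16 * v m := by
    have hterm : ∀ i' ∈ range m, ε m i' * ρ i' ≤ 7 / 5 * v m * (5 / 21 : ℝ) ^ (m - i') := by
      intro i' hi'
      have hi'm : i' < m := mem_range.mp hi'
      have hρi' : 0 ≤ ρ i' := hρ i' (by omega)
      have hc : 0 ≤ 2 * (1 / 14 : ℝ) ^ (m - i') := by positivity
      calc ε m i' * ρ i' ≤ 2 * (1 / 14 : ℝ) ^ (m - i') * ρ i' := mul_le_mul_of_nonneg_right (hε' m (by omega) i' hi'm) hρi'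
        _ ≤ 2 * (1 / 14 : ℝ) ^ (m - i') * (7 / 10 * v i') := mul_le_mul_of_nonneg_left (hmain i' hi'm) hc
        _ ≤ 2 * (1 / 14 : ℝ) ^ (m - i') * (7 / 10 * ((10 / 3) ^ (m - i') * v m)) :=
            mul_le_mul_of_nonneg_left (by linarith [hchain i' hi'm.le]) hc
        _ = 7 / 5 * v m * ((1 / 14 : ℝ) ^ (m - i') * (10 / 3) ^ (m - i')) := by ring
        _ = 7 / 5 * v m * (5 / 21 : ℝ) ^ (m - i') := by rw [← mul_pow]; norm_num
    calc ∑ i' ∈ range m, ε m i' * ρ i' ≤ ∑ i' ∈ range m, 7 / 5 * v m * (5 / 21 : ℝ) ^ (m - i') := sum_le_sum hterm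
      _ = 7 / 5 * v m * ∑ i' ∈ range m, (5 / 21 : ℝ) ^ (m - i') := by rw [mul_sum]
      _ ≤ 7 / 5 * v m * (5 / 16) := mul_le_mul_of_nonneg_left (geom_sum_le m) (by positivity)
      _ = 7 / 16 * v m := by ring
  have hsm := hsys m (Nat.lt_succ_self m)
  have hsplit : η - ∑ i' ∈ range m, (1 - ε m i') * ρ i' = v m + ∑ i' ∈ range m, ε m i' * ρ i' := by
    simp only [hv_def]
    rw [sub_add, ← sum_sub_distrib]
    exact congrArg _ (sum_congr rfl fun i' _ => by ring)
  rw [hsplit] at hsm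
  have hxm := hx m (Nat.lt_succ_self m)
  have hxm0 := hx0 m (Nat.lt_succ_self m)
  have hgm := hg' m (Nat.lt_succ_self m)
  have hρm := hρ m (Nat.lt_succ_self m)
  have h1 : ρ m * (1 + g m * x m) ≤ x m * (23 / 16 * v m) := hsm.trans (mul_le_mul_of_nonneg_left (by linarith) hxm0)
  have h1' : ρ m * (1 + 1 / 4 * x m) ≤ ρ m * (1 + g m * x m) := mul_le_mul_of_nonneg_left (by nlinarith) hρm
  have h2 : x m * (23 / 16 * v m) ≤ v m * (1 + 1 / 4 * x m) := by
    have : x m * (23 / 16) ≤ 1 + 1 / 4 * x m := by linarith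
    nlinarith
  have hlast : ρ m ≤ v m := le_of_mul_le_mul_right ((h1'.trans h1).trans h2) (by linarith)
  rw [sum_range_succ]
  simp only [hv_def] at hlast
  linarith

end Summit.QuantumFields.BalabanUV.Beta.EriceRemainderEnclosureHistoryAutonomyComparisonSlackSystemSharp

end
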